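import Mathlib.Topology.MetricSpace.Pseudo.Lemmas
import Mathlib.Topology.MetricSpace.Bounded
import Mathlib.Topology.Sequences
import Mathlib.Topology.UniformSpace.HeineCantor
import Mathlib.Topology.Connected.PathConnected
import Mathlib.Topology.Order.IntermediateValue
import Mathlib.Analysis.SpecificLimits.Basic
import HarnessLib

/-!
# Uniformly locally connected compact sets; continuous images of intervals (plane topology)

Pommerenke, *Boundary Behaviour of Conformal Maps* (1992), §2.2, calls a closed set `A ⊆ ℂ`
**locally connected** if for every `ε > 0` there is `δ > 0` such that any two points `a, b ∈ A`
with `|a - b| < δ` lie in a continuum `B ⊆ A` of diameter `< ε`. This *uniform* notion is the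
hypothesis of Carathéodory's continuity theorem in the form "(iv) `ℂ ∖ G` is locally connected
⇒ (i) `f : 𝔻 → G` has a continuous extension to the closed disc" (op. cit., Thm. 2.1), whose
proof (p. 21) only uses: nearby boundary points are joined by a small continuum in the
complement of `G`. We formalise the notion in a general metric space and prove the two
closure properties needed for the Loewner trace
(`Literature.Probability.RandomPlanarGeometry.LoewnerTraceLimit`):

* `Literature.IsUniformlyLocallyConnected P` — the predicate (continua are taken compact and
  preconnected, and asked to lie in the closed `η`-ball about the first point);
* `Literature.Topology.PlaneTopology.IsUniformlyLocallyConnected.of_image_Icc` — **a continuous image of a compact interval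
  is uniformly locally connected** ("every continuous curve is a locally connected continuum",
  the easy half of the Hahn–Mazurkiewicz theorem): if not, there are `f uₙ, f vₙ` at distance
  `→ 0` not joined by small continua; by compactness `uₙ → u`, `vₙ → v` along a subsequence with
  `f u = f v`, and `f [uₙ, u] ∪ f [v, vₙ]` is a small continuum joining them;
* `Literature.Topology.PlaneTopology.IsUniformlyLocallyConnected.union` — **the union of two compact uniformly locally
  connected sets is uniformly locally connected**: close points `a ∈ A`, `b ∈ B` have a point of
  `A ∩ B` nearby (`exists_forall_dist_inter_lt`, compactness), through which the two small
  continua are concatenated.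

## Mathlib

We USE `IsCompact.tendsto_subseq` (Bolzano–Weierstrass), `IsCompact.uniformContinuousOn_of_continuous`
(Heine–Cantor), `IsCompact.exists_isMinOn`, `isPreconnected_uIcc`, `IsPreconnected.union`.
Mathlib has `LocallyConnectedSpace` (a property of a topology, pointwise) but not this uniform
metric notion for subsets.

## References

* Ch. Pommerenke, *Boundary Behaviour of Conformal Maps*, Springer (1992), §2.2 (definition of
  a locally connected closed set; "every curve is a locally connected continuum"), Thm. 2.1.
-/

noncomputable section

open Set Filter Topology Metric

namespace Literature.Topology.PlaneTopology

variable {X : Type*} [MetricSpace X]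

/-- A set `P` in a metric space is **uniformly locally connected** (Pommerenke's "locally
connected closed set"): for every `η > 0` there is `δ > 0` such that any two points `a, b ∈ P`
with `dist a b < δ` lie in a compact (pre)connected set `σ ⊆ P` contained in the closed ball
of radius `η` about `a`. Pommerenke (1992), §2.2 (definition before Thm. 2.1).
[cite: PommerenkeBBCM1992, §2.2] -/
def IsUniformlyLocallyConnected (P : Set X) : Prop :=
  ∀ η > 0, ∃ δ > 0, ∀ a ∈ P, ∀ b ∈ P, dist a b < δ →
    ∃ σ ⊆ P, IsCompact σ ∧ IsPreconnected σ ∧ a ∈ σ ∧ b ∈ σ ∧ σ ⊆ closedBall a η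

namespace IsUniformlyLocallyConnected

/-- Unfolding lemma. [folklore] -/
theorem def_iff {P : Set X} : IsUniformlyLocallyConnected P ↔
    ∀ η > 0, ∃ δ > 0, ∀ a ∈ P, ∀ b ∈ P, dist a b < δ →
      ∃ σ ⊆ P, IsCompact σ ∧ IsPreconnected σ ∧ a ∈ σ ∧ b ∈ σ ∧ σ ⊆ closedBall a η := Iff.rfl

/-- The empty set is uniformly locally connected. [folklore] -/
theorem empty : IsUniformlyLocallyConnected (∅ : Set X) :=
  fun _ _ ↦ ⟨1, one_pos, fun _ ha ↦ absurd ha (notMem_empty _)⟩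

/-! ### Continuous images of compact intervals -/

/-- The image of a compact subinterval under a map continuous on `[a, b]` is a compact
preconnected set. [folklore] -/
theorem isCompact_isPreconnected_image_uIcc {f : ℝ → X} {a b : ℝ}
    (hf : ContinuousOn f (Icc a b)) {u v : ℝ} (hu : u ∈ Icc a b) (hv : v ∈ Icc a b) :
    IsCompact (f '' uIcc u v) ∧ IsPreconnected (f '' uIcc u v) := by
  have hsub : uIcc u v ⊆ Icc a b := uIcc_subset_Icc hu hv
  exact ⟨isCompact_uIcc.image_of_continuousOn (hf.mono hsub),
    isPreconnected_uIcc.image _ (hf.mono hsub)⟩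

/-- **A continuous image of a compact interval is uniformly locally connected** ("every curve
is a locally connected continuum"). Pommerenke (1992), §2.2. [cite: PommerenkeBBCM1992, §2.2] -/
theorem of_image_Icc {f : ℝ → X} {a b : ℝ} (hf : ContinuousOn f (Icc a b)) :
    IsUniformlyLocallyConnected (f '' Icc a b) := by
  intro η hη
  by_contra hcon
  push Not at hcon
  -- for every `n` a bad pair at distance `< 1/(n+1)`
  have hbad : ∀ n : ℕ, ∃ u ∈ Icc a b, ∃ v ∈ Icc a b, dist (f u) (f v) < 1 / ((n : ℝ) + 1) ∧
      ∀ σ ⊆ f '' Icc a b, IsCompact σ → IsPreconnected σ → f u ∈ σ → f v ∈ σ →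
        ¬ σ ⊆ closedBall (f u) η := by
    intro n
    obtain ⟨x, hx, y, hy, hxy, hno⟩ := hcon (1 / ((n : ℝ) + 1)) (by positivity)
    obtain ⟨u, hu, rfl⟩ := hx
    obtain ⟨v, hv, rfl⟩ := hy
    exact ⟨u, hu, v, hv, hxy, fun σ hσ hK hc hu' hv' hball ↦ hno σ hσ hK hc hu' hv' hball⟩
  choose u hu v hv hdist hno using hbad
  -- a convergent subsequence of `(uₙ, vₙ)` in the compact square
  have hK : IsCompact (Icc a b ×ˢ Icc a b) := isCompact_Icc.prod isCompact_Icc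
  obtain ⟨⟨u₀, v₀⟩, ⟨hu₀, hv₀⟩, φ, hφ, hlim⟩ :=
    hK.tendsto_subseq (x := fun n ↦ (u n, v n)) fun n ↦ ⟨hu n, hv n⟩
  have hlu : Tendsto (fun n ↦ u (φ n)) atTop (𝓝 u₀) := (continuous_fst.tendsto _).comp hlim
  have hlv : Tendsto (fun n ↦ v (φ n)) atTop (𝓝 v₀) := (continuous_snd.tendsto _).comp hlim
  -- `f u₀ = f v₀`
  have hfu : Tendsto (fun n ↦ f (u (φ n))) atTop (𝓝 (f u₀)) :=
    ((hf u₀ hu₀).tendsto).comp (tendsto_nhdsWithin_iff.2 ⟨hlu, Eventually.of_forall fun n ↦ hu _⟩)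
  have hfv : Tendsto (fun n ↦ f (v (φ n))) atTop (𝓝 (f v₀)) :=
    ((hf v₀ hv₀).tendsto).comp (tendsto_nhdsWithin_iff.2 ⟨hlv, Eventually.of_forall fun n ↦ hv _⟩)
  have hφge : ∀ n, n ≤ φ n := fun n ↦ hφ.id_le n
  have hd0 : Tendsto (fun n ↦ dist (f (u (φ n))) (f (v (φ n)))) atTop (𝓝 0) := by
    have h1 : Tendsto (fun n : ℕ ↦ 1 / ((n : ℝ) + 1)) atTop (𝓝 0) :=
      tendsto_one_div_add_atTop_nhds_zero_nat
    refine squeeze_zero (fun n ↦ dist_nonneg) (fun n ↦ (hdist (φ n)).le.trans ?_) h1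
    exact one_div_le_one_div_of_le (by positivity) (by exact_mod_cast Nat.succ_le_succ (hφge n))
  have heq : f u₀ = f v₀ := by
    have h1 : Tendsto (fun n ↦ dist (f (u (φ n))) (f (v (φ n)))) atTop
        (𝓝 (dist (f u₀) (f v₀))) := hfu.dist hfv
    exact dist_eq_zero.1 (tendsto_nhds_unique h1 hd0)
  -- uniform continuity of `f` on `[a, b]`
  obtain ⟨θ, hθ, hunif⟩ := Metric.uniformContinuousOn_iff.1
    (isCompact_Icc.uniformContinuousOn_of_continuous hf) (η / 2) (by positivity)
  -- for large `n`, `uₙ, vₙ` are `θ`-close to `u₀, v₀`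
  obtain ⟨n, hnu, hnv⟩ : ∃ n, dist (u (φ n)) u₀ < θ ∧ dist (v (φ n)) v₀ < θ := by
    have h1 := (Metric.tendsto_nhds.1 hlu θ hθ).and (Metric.tendsto_nhds.1 hlv θ hθ)
    exact h1.exists
  -- the small continuum `f [uₙ, u₀] ∪ f [v₀, vₙ]`
  set σ : Set X := f '' uIcc (u (φ n)) u₀ ∪ f '' uIcc v₀ (v (φ n)) with hσ
  have hσsub : σ ⊆ f '' Icc a b := union_subset (image_mono (uIcc_subset_Icc (hu _) hu₀))
    (image_mono (uIcc_subset_Icc hv₀ (hv _)))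
  obtain ⟨hK1, hc1⟩ := isCompact_isPreconnected_image_uIcc hf (hu (φ n)) hu₀
  obtain ⟨hK2, hc2⟩ := isCompact_isPreconnected_image_uIcc hf hv₀ (hv (φ n))
  have hcommon1 : f u₀ ∈ f '' uIcc (u (φ n)) u₀ := ⟨u₀, right_mem_uIcc, rfl⟩
  have hcommon2 : f u₀ ∈ f '' uIcc v₀ (v (φ n)) := ⟨v₀, left_mem_uIcc, heq.symm⟩
  have hσc : IsPreconnected σ := hc1.union (f u₀) hcommon1 hcommon2 hc2
  have hσK : IsCompact σ := hK1.union hK2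
  have huσ : f (u (φ n)) ∈ σ := Or.inl ⟨u (φ n), left_mem_uIcc, rfl⟩
  have hvσ : f (v (φ n)) ∈ σ := Or.inr ⟨v (φ n), right_mem_uIcc, rfl⟩
  -- it lies in the closed `η`-ball about `f uₙ`
  have hball : σ ⊆ closedBall (f (u (φ n))) η := by
    have hcenter : dist (f u₀) (f (u (φ n))) < η / 2 := by
      rw [dist_comm]
      exact hunif _ (hu _) _ hu₀ hnu
    rintro z (⟨w, hw, rfl⟩ | ⟨w, hw, rfl⟩)
    · rw [mem_closedBall]
      have hw' : w ∈ Icc a b := uIcc_subset_Icc (hu _) hu₀ hw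
      have hwu : dist w (u (φ n)) < θ := by
        have h1 : dist w (u (φ n)) ≤ dist u₀ (u (φ n)) := by
          rw [Real.dist_eq, Real.dist_eq]
          exact abs_sub_left_of_mem_uIcc hw
        rw [dist_comm u₀] at h1
        exact lt_of_le_of_lt h1 hnu
      exact (hunif w hw' _ (hu _) hwu).le.trans (by linarith)
    · rw [mem_closedBall]
      have hw' : w ∈ Icc a b := uIcc_subset_Icc hv₀ (hv _) hw
      have hwv : dist w v₀ < θ := by
        have h1 : dist w v₀ ≤ dist (v (φ n)) v₀ := by
          rw [Real.dist_eq, Real.dist_eq]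
          exact abs_sub_left_of_mem_uIcc hw
        exact lt_of_le_of_lt h1 hnv
      calc dist (f w) (f (u (φ n))) ≤ dist (f w) (f v₀) + dist (f v₀) (f (u (φ n))) :=
            dist_triangle _ _ _
        _ ≤ η / 2 + η / 2 := by
            refine add_le_add (hunif w hw' v₀ hv₀ hwv).le ?_
            rw [← heq]
            exact hcenter.le
        _ = η := by ring
  exact hno (φ n) σ hσsub hσK hσc huσ hvσ hball

/-! ### Unions of compact uniformly locally connected sets -/

/-- **Close points of two compact sets have a nearby common point**: for compact `A, B` and
`ε > 0` there is `δ > 0` such that whenever `a ∈ A`, `b ∈ B` with `dist a b < δ`, some point of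
`A ∩ B` is within `ε` of `a`. (The compact set of points of `A` that are `ε`-far from `A ∩ B`
misses `B`, hence is at positive distance from it.) [folklore] -/
theorem _root_.Literature.Topology.PlaneTopology.exists_forall_dist_inter_lt {A B : Set X} (hA : IsCompact A) (hB : IsCompact B)
    {ε : ℝ} (hε : 0 < ε) :
    ∃ δ > 0, ∀ a ∈ A, ∀ b ∈ B, dist a b < δ → ∃ c ∈ A ∩ B, dist a c < ε := by
  -- the far set `S = {a ∈ A | ∀ c ∈ A ∩ B, ε ≤ dist a c}`
  set S : Set X := A ∩ ⋂ c ∈ A ∩ B, {a | ε ≤ dist a c} with hS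
  have hSc : IsClosed (⋂ c ∈ A ∩ B, {a : X | ε ≤ dist a c}) :=
    isClosed_biInter fun c _ ↦ isClosed_le continuous_const (continuous_id.dist continuous_const)
  have hSK : IsCompact S := hA.inter_right hSc
  have hSB : ∀ a ∈ S, a ∉ B := fun a ha haB ↦ by
    have h1 := mem_iInter₂.1 ha.2 a ⟨ha.1, haB⟩
    simp only [mem_setOf_eq, dist_self] at h1
    linarith
  have hgood : ∀ a ∈ A, a ∉ S → ∃ c ∈ A ∩ B, dist a c < ε := fun a ha haS ↦ by
    by_contra hno
    push Not at hno
    exact haS ⟨ha, mem_iInter₂.2 fun c hc ↦ hno c hc⟩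
  rcases S.eq_empty_or_nonempty with hSe | hSne
  · refine ⟨1, one_pos, fun a ha b _ _ ↦ hgood a ha (by rw [hSe]; exact notMem_empty a)⟩
  rcases B.eq_empty_or_nonempty with hBe | hBne
  · exact ⟨1, one_pos, fun a _ b hb _ ↦ by rw [hBe] at hb; exact absurd hb (notMem_empty b)⟩
  -- positive distance between the disjoint compact sets `S` and `B`
  have hcont : ContinuousOn (fun p : X × X ↦ dist p.1 p.2) (S ×ˢ B) := continuous_dist.continuousOn
  obtain ⟨⟨a₀, b₀⟩, ⟨ha₀, hb₀⟩, hmin⟩ := (hSK.prod hB).exists_isMinOn (hSne.prod hBne) hcont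
  have hpos : 0 < dist a₀ b₀ := dist_pos.2 fun h ↦ hSB a₀ ha₀ (h ▸ hb₀)
  refine ⟨dist a₀ b₀, hpos, fun a ha b hb hab ↦ hgood a ha fun haS ↦ ?_⟩
  have := hmin (a := (a, b)) ⟨haS, hb⟩
  exact absurd this (not_le.2 hab)

/-- **The union of two compact uniformly locally connected sets is uniformly locally
connected.** Close points in different pieces are joined through a nearby point of the
intersection (`exists_forall_dist_inter_lt`). Pommerenke (1992), §2.2 (a finite union of
locally connected continua is locally connected). [cite: PommerenkeBBCM1992, §2.2] -/
theorem union {A B : Set X} (hA : IsUniformlyLocallyConnected A) (hB : IsUniformlyLocallyConnected B)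
    (hAK : IsCompact A) (hBK : IsCompact B) : IsUniformlyLocallyConnected (A ∪ B) := by
  -- symmetric core: close `a ∈ P`, `b ∈ Q` are joined by a small continuum of `P ∪ Q`
  have key : ∀ {P Q : Set X}, IsUniformlyLocallyConnected P → IsUniformlyLocallyConnected Q →
      IsCompact P → IsCompact Q → ∀ η > 0, ∃ δ > 0, ∀ a ∈ P, ∀ b ∈ Q, dist a b < δ →
        ∃ σ ⊆ P ∪ Q, IsCompact σ ∧ IsPreconnected σ ∧ a ∈ σ ∧ b ∈ σ ∧ σ ⊆ closedBall a η := by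
    intro P Q hP hQ hPK hQK η hη
    obtain ⟨δP, hδP, hPσ⟩ := hP (η / 2) (by positivity)
    obtain ⟨δQ, hδQ, hQσ⟩ := hQ (η / 2) (by positivity)
    obtain ⟨δ₀, hδ₀, hnear⟩ := exists_forall_dist_inter_lt hPK hQK (ε := min δP (δQ / 2))
      (lt_min hδP (by positivity))
    refine ⟨min δ₀ (δQ / 2), lt_min hδ₀ (by positivity), fun a ha b hb hab ↦ ?_⟩
    obtain ⟨c, ⟨hcP, hcQ⟩, hac⟩ := hnear a ha b hb (lt_of_lt_of_le hab (min_le_left _ _))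
    have hacP : dist a c < δP := lt_of_lt_of_le hac (min_le_left _ _)
    have hca' : dist c a < δQ / 2 := by
      rw [dist_comm]
      exact lt_of_lt_of_le hac (min_le_right _ _)
    have hab' : dist a b < δQ / 2 := lt_of_lt_of_le hab (min_le_right _ _)
    have hcb : dist c b < δQ := by
      calc dist c b ≤ dist c a + dist a b := dist_triangle _ _ _
        _ < δQ / 2 + δQ / 2 := add_lt_add hca' hab'
        _ = δQ := by ring
    obtain ⟨σ₁, hσ₁P, hσ₁K, hσ₁c, haσ₁, hcσ₁, hσ₁ball⟩ := hPσ a ha c hcP hacP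
    obtain ⟨σ₂, hσ₂Q, hσ₂K, hσ₂c, hcσ₂, hbσ₂, hσ₂ball⟩ := hQσ c hcQ b hb hcb
    refine ⟨σ₁ ∪ σ₂, union_subset (hσ₁P.trans subset_union_left) (hσ₂Q.trans subset_union_right),
      hσ₁K.union hσ₂K, hσ₁c.union c hcσ₁ hcσ₂ hσ₂c, Or.inl haσ₁, Or.inr hbσ₂, ?_⟩
    have hca : dist c a ≤ η / 2 := mem_closedBall.1 (hσ₁ball hcσ₁)
    rintro z (hz | hz)
    · exact closedBall_subset_closedBall (by linarith) (hσ₁ball hz)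
    · rw [mem_closedBall]
      calc dist z a ≤ dist z c + dist c a := dist_triangle _ _ _
        _ ≤ η / 2 + η / 2 := add_le_add (mem_closedBall.1 (hσ₂ball hz)) hca
        _ = η := by ring
  intro η hη
  obtain ⟨δ₁, hδ₁, h₁⟩ := key hA hB hAK hBK η hη
  obtain ⟨δ₂, hδ₂, h₂⟩ := key hB hA hBK hAK η hη
  obtain ⟨δA, hδA, hA'⟩ := hA η hη
  obtain ⟨δB, hδB, hB'⟩ := hB η hη
  refine ⟨min (min δ₁ δ₂) (min δA δB), lt_min (lt_min hδ₁ hδ₂) (lt_min hδA hδB),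
    fun a ha b hb hab ↦ ?_⟩
  rcases ha with ha | ha <;> rcases hb with hb | hb
  · obtain ⟨σ, hσ, h⟩ := hA' a ha b hb (lt_of_lt_of_le hab ((min_le_right _ _).trans (min_le_left _ _)))
    exact ⟨σ, hσ.trans subset_union_left, h⟩
  · exact h₁ a ha b hb (lt_of_lt_of_le hab ((min_le_left _ _).trans (min_le_left _ _)))
  · obtain ⟨σ, hσ, h⟩ := h₂ a ha b hb (lt_of_lt_of_le hab ((min_le_left _ _).trans (min_le_right _ _)))
    exact ⟨σ, hσ.trans (union_comm A B ▸ Subset.rfl), h⟩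
  · obtain ⟨σ, hσ, h⟩ := hB' a ha b hb (lt_of_lt_of_le hab ((min_le_right _ _).trans (min_le_right _ _)))
    exact ⟨σ, hσ.trans subset_union_right, h⟩

/-- Uniform local connectedness is invariant under isometric re-description: transport along an
equality of sets. [folklore] -/
theorem congr {P Q : Set X} (h : IsUniformlyLocallyConnected P) (hPQ : P = Q) :
    IsUniformlyLocallyConnected Q := hPQ ▸ h

end IsUniformlyLocallyConnected

end Literature.Topology.PlaneTopology
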